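import Mathlib
import Literature.NumberTheory.LFunctions.Zhang2022.TypedSection15C
import Literature.NumberTheory.LFunctions.Zhang2022.Section15Eval1524
import Literature.NumberTheory.LFunctions.Zhang2022.Section15RhoProductsRate
import Literature.NumberTheory.Multiplicative.SigmaTotientExtremalOrders
import HarnessLib

/-!
# Zhang (2022) §15 pp. 87–88: (15.22) + u056 ⇒ (15.23) with the rate it actually yields (`O(1/𝓛)`),
# and the step to (15.24) along that repaired rate (`D/φ(D) ≪ log log D`)

Topic `Literature/NumberTheory/LFunctions/Zhang2022` (Landau–Siegel audit tree; verdict-neutral).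
Y. Zhang, *Discrete mean estimates and the Landau–Siegel zero*, arXiv:2211.02515v1 (2022)
[Zhang2022LandauSiegel] — an unrefereed manuscript under adjudication (cell siegel-zhang, D-0069,
discharge lane, node `Skeleton.Ded1524`). §15 p. 88 (tex L4371–L4373): "It follows by (15.22) that
`𝒮₁ⱼ = 𝔢ⱼ𝔞φ(D)/D + O(1/𝓛³)` (15.23)", where (15.22) (tex L4306) is `𝒮₁ⱼ = 𝔢ⱼ𝓜₁(1,1;1−βⱼ)Σ_{n∈𝒩(𝒬),
n<T} χ(n)τ₂(n)ϖ₁ⱼ(n)/n + O(1/𝓛)` and u056 (tex L4363–L4365) is `𝓜₁(1,1;1−βⱼ)Σ_{n∈𝒩(𝒬),n<T}… =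
𝔞φ(D)/D + O(1/𝓛³)`. The cell's GAP row G-L4t3-3 records that these two inputs give (15.23) only
with the error `O(1/𝓛)` (the typed repair candidate `Typed.Section15C.Eq15_23R`). This file
kernel-checks exactly that —

* `eq15_23R_of_eq15_22` — **(15.22) + u056 ⇒ (15.23) with `O(1/𝓛)`** (`Eq15_22 c′ X → Step15_u056 c′
  X → Eq15_23R c′ X`, for every instantiation `X` of the §15A/B objects): `𝒮₁ⱼ − 𝔢ⱼ𝔞φ/D =
  [𝒮₁ⱼ − 𝔢ⱼ𝓜₁Σ] + 𝔢ⱼ[𝓜₁Σ − 𝔞φ/D]`;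

— and that the repaired rate still suffices for (15.24), because the loss is only against the
factor `D/φ(D)` of (15.17), and `D/φ(D) ≤ 2 log log D` for large `D` (Landau; the tree's
`Multiplicative.ExtremalOrder.eventually_le_totient_mul_loglog_div` with `c = 1/2 < e^{−γ}`, [HardyWright2008]
Thm 328), so `(D/φ(D))·O(1/𝓛) → 0`:

* `self_div_totient_le_two_mul_loglog` — `D/φ(D) ≤ 2 log 𝓛` for `D ≥ D₁`;
* `eta_small_of_rate1` — `(D/φ(D))·|𝒮₁ⱼ − 𝔢ⱼ𝔞φ(D)/D| → 0` from the rate `O(1/𝓛)`;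
* `eval1524_of_rates_R` — (15.6) + (15.17) + (15.23)-with-`O(1/𝓛)` + `ℛ₁*ℛ₁ⱼ = (1,2,1) + O(𝓛⁻⁵)`
  ⇒ (15.24), abstract; `eval1524_of_displays_R` — the instantiation: `Eq15_6 → Eq15_17 → Eq15_22 →
  Step15_u056 → Step15_u058 → Step15_u059 → Skeleton.Eval1524 c′` (so (15.23) is bypassed: the leaf
  (15.24) rests on (15.6), (15.17), (15.22), u056, u058, u059).

WHAT THIS IS NOT: a proof of (15.22) or u056 (CLAIM nodes; their inputs are Lemma 15.1 and Lemmas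
15.2–15.3), nor any claim about Theorems 1–2 of the manuscript or Landau–Siegel zeros.

## References
* Y. Zhang, arXiv:2211.02515v1 (2022), §15 pp. 87–88, (15.22), (15.23), (15.24).
  [cite: Zhang2022LandauSiegel, §15 (15.23) p.88]
* G. H. Hardy, E. M. Wright, *An Introduction to the Theory of Numbers*, Thm 328. [cite: HardyWright2008, Thm 328]
-/

noncomputable section

open Complex Real ComplexConjugate Filter
open Literature.NumberTheory.LFunctions.Zhang2022.Skeleton
open Literature.NumberTheory.LFunctions.Zhang2022.Typed

namespace Literature.NumberTheory.LFunctions.Zhang2022.Ded1524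

/-! ## 1. (15.22) + u056 ⇒ (15.23) with `O(1/𝓛)` -/

/-- **(15.22) and u056 give (15.23) with the error `O(1/𝓛)`** (the repair candidate `Eq15_23R` of
the cell's row G-L4t3-3), for every instantiation `X` of the §15A/B objects: `𝒮₁ⱼ − 𝔢ⱼ𝔞φ(D)/D =
(𝒮₁ⱼ − 𝔢ⱼ𝓜₁(1,1;1−βⱼ)Σ) + 𝔢ⱼ(𝓜₁(1,1;1−βⱼ)Σ − 𝔞φ(D)/D)`, of norm `≤ C/𝓛 + |𝔢ⱼ|C′/𝓛³ ≤ (C + |𝔢ⱼ|C′)/𝓛`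
once `𝓛 ≥ 1`. [cite: Zhang2022LandauSiegel, §15 (15.23) p.88] -/
theorem eq15_23R_of_eq15_22 (c' : ℝ) (X : Section15C.Inputs15AB) (h22 : Section15C.Eq15_22 c' X)
    (h56 : Section15C.Step15_u056 c' X) : Section15C.Eq15_23R c' X := by
  obtain ⟨C, hC⟩ := h22
  obtain ⟨C', hC'⟩ := h56
  set K : ℝ := ‖frake 1‖ + ‖frake 2‖ + ‖frake 3‖ with hK
  have hT : ForAllLarge fun D _ _ => (1 : ℝ) ≤ ell D := by
    refine ForAllLarge.of_le ⌈Real.exp 1⌉₊ fun D _ _ hD _ _ => ?_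
    have h : Real.exp 1 ≤ D := le_trans (Nat.le_ceil _) (by exact_mod_cast hD)
    exact (Real.le_log_iff_exp_le (lt_of_lt_of_le (Real.exp_pos _) h)).mpr h
  obtain ⟨D₀, h⟩ := (hC.and hC').and hT
  refine ⟨|C| + K * |C'|, D₀, fun D _ χ hD hq hp hA j hj => ?_⟩
  obtain ⟨⟨h1, h2⟩, hℓ1⟩ := h D χ hD hq hp
  have g1 := h1 hA j hj
  have g2 := h2 hA j hj
  have hℓ0 : 0 < ell D := by linarith
  have hKj : ‖frake j‖ ≤ K := by
    simp only [Finset.mem_insert, Finset.mem_singleton] at hj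
    rcases hj with rfl | rfl | rfl <;> simp only [hK] <;> linarith [norm_nonneg (frake 1),
      norm_nonneg (frake 2), norm_nonneg (frake 3)]
  set M : ℂ := X.calM1 c' χ 1 1 (1 - betaJ c' D j) * Section15C.sumInN c' X χ j with hM
  have key : X.calS1 c' χ j - frake j * (frakA χ : ℂ) * (Nat.totient D : ℂ) / (D : ℂ) =
      (X.calS1 c' χ j - frake j * X.calM1 c' χ 1 1 (1 - betaJ c' D j) * Section15C.sumInN c' X χ j) +
        frake j * (M - (frakA χ : ℂ) * (Nat.totient D : ℂ) / (D : ℂ)) := by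
    rw [hM]; ring
  rw [key]
  have e1 : ‖X.calS1 c' χ j - frake j * X.calM1 c' χ 1 1 (1 - betaJ c' D j) *
      Section15C.sumInN c' X χ j‖ ≤ |C| / ell D := g1.trans (by gcongr; exact le_abs_self C)
  have e2 : ‖frake j * (M - (frakA χ : ℂ) * (Nat.totient D : ℂ) / (D : ℂ))‖ ≤ K * (|C'| / ell D) := by
    rw [norm_mul]
    refine mul_le_mul hKj (g2.trans ?_) (norm_nonneg _) (by positivity)
    calc C' / ell D ^ 3 ≤ |C'| / ell D ^ 3 := by gcongr; exact le_abs_self C'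
      _ ≤ |C'| / ell D := by
          apply div_le_div_of_nonneg_left (abs_nonneg _) hℓ0
          calc ell D = ell D ^ 1 := (pow_one _).symm
            _ ≤ ell D ^ 3 := pow_le_pow_right₀ hℓ1 (by norm_num)
  calc ‖(X.calS1 c' χ j - frake j * X.calM1 c' χ 1 1 (1 - betaJ c' D j) * Section15C.sumInN c' X χ j) +
        frake j * (M - (frakA χ : ℂ) * (Nat.totient D : ℂ) / (D : ℂ))‖
      ≤ |C| / ell D + K * (|C'| / ell D) := (norm_add_le _ _).trans (add_le_add e1 e2)
    _ = (|C| + K * |C'|) / ell D := by ring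

/-! ## 2. `D/φ(D) ≤ 2 log log D`, and the step to (15.24) along the repaired rate -/

/-- **`D/φ(D) ≤ 2 log 𝓛` for all large `D`** (`𝓛 = log D`), from Landau's `lim inf φ(n) log log n/n =
e^{−γ}` in the form of the tree's `eventually_le_totient_mul_loglog_div` with `c = 1/2 < e^{−γ}`
(`γ < 2/3 < log 2`). [cite: HardyWright2008, Thm 328] -/
theorem self_div_totient_le_two_mul_loglog :
    ∃ D₁ : ℕ, ∀ D : ℕ, D₁ ≤ D → (D : ℝ) / Nat.totient D ≤ 2 * Real.log (ell D) := by
  have hc : (1 / 2 : ℝ) < Real.exp (-Real.eulerMascheroniConstant) := by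
    have h1 : Real.exp (2 / 3) < 2 := by
      calc Real.exp (2 / 3) < Real.exp (Real.log 2) :=
            Real.exp_lt_exp.mpr (by linarith [Real.log_two_gt_d9])
        _ = 2 := Real.exp_log (by norm_num)
    have h2 : Real.exp (-(2 / 3 : ℝ)) ≤ Real.exp (-Real.eulerMascheroniConstant) :=
      Real.exp_le_exp.mpr (by linarith [Real.eulerMascheroniConstant_lt_two_thirds])
    refine lt_of_lt_of_le ?_ h2
    rw [Real.exp_neg, lt_inv_comm₀ (by norm_num) (Real.exp_pos _)]
    norm_num at h1 ⊢; exact h1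
  have hev := Literature.NumberTheory.Multiplicative.ExtremalOrder.eventually_le_totient_mul_loglog_div hc
  obtain ⟨N, hN⟩ := Filter.eventually_atTop.mp (hev.and (Filter.eventually_ge_atTop 3))
  refine ⟨N, fun D hD => ?_⟩
  obtain ⟨h1, h3⟩ := hN D hD
  have hD0 : (0 : ℝ) < D := by exact_mod_cast (show 0 < D by omega)
  have hφ : (0 : ℝ) < Nat.totient D := by exact_mod_cast Nat.totient_pos.mpr (by omega)
  -- from `1/2 ≤ φ(D) log log D / D`: `D/φ(D) ≤ 2 log log D`
  rw [ell, div_le_iff₀ hφ]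
  rw [le_div_iff₀ hD0] at h1
  linarith

/-- The rate `O(1/𝓛)` of the REPAIRED (15.23) (`Eq15_23R`) still gives
`(D/φ(D))·|𝒮₁ⱼ − 𝔢ⱼ𝔞φ(D)/D| → 0`, since `D/φ(D) ≤ 2 log 𝓛` and `log 𝓛/𝓛 → 0`.
[cite: Zhang2022LandauSiegel, §15 (15.23) p.88] -/
theorem eta_small_of_rate1 {S : ∀ (D : ℕ) [NeZero D], DirichletCharacter ℂ D → ℕ → ℂ}
    (h23 : ∃ C : ℝ, ForAllLarge fun D _ χ => AssumptionA D χ → ∀ j ∈ ({1, 2, 3} : Finset ℕ),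
      ‖S D χ j - frake j * (frakA χ : ℂ) * (Nat.totient D : ℂ) / (D : ℂ)‖ ≤ C / ell D) :
    ∀ ε : ℝ, 0 < ε → ForAllLarge fun D _ χ => AssumptionA D χ → ∀ j ∈ ({1, 2, 3} : Finset ℕ),
      (D : ℝ) / Nat.totient D * ‖S D χ j - frake j * (frakA χ : ℂ) * (Nat.totient D : ℂ) / (D : ℂ)‖
        ≤ ε := by
  intro ε hε
  obtain ⟨C, hC⟩ := h23
  obtain ⟨D₁, hD₁⟩ := self_div_totient_le_two_mul_loglog
  -- threshold: `𝓛 ≥ M` with `M ≥ 1` and `M ≥ (4|C|/ε)²`, so that `2 log 𝓛 · |C|/𝓛 ≤ 2√𝓛·|C|/𝓛 ≤ ε`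
  set M : ℝ := max 1 ((4 * |C| / ε) ^ 2) with hM
  have hT : ForAllLarge fun D _ _ => M ≤ ell D ∧ (D : ℝ) / Nat.totient D ≤ 2 * Real.log (ell D) := by
    refine ForAllLarge.of_le (max ⌈Real.exp M⌉₊ D₁) fun D _ _ hD _ _ => ⟨?_, hD₁ D ?_⟩
    · have h : Real.exp M ≤ D :=
        le_trans (Nat.le_ceil _) (by exact_mod_cast (le_max_left _ _).trans hD)
      exact (Real.le_log_iff_exp_le (lt_of_lt_of_le (Real.exp_pos _) h)).mpr h
    · exact (le_max_right _ _).trans hD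
  obtain ⟨D₀, h⟩ := hC.and hT
  refine ⟨D₀, fun D _ χ hD hq hp hA j hj => ?_⟩
  obtain ⟨h1, hMℓ, ht⟩ := h D χ hD hq hp
  have hℓ1 : 1 ≤ ell D := (le_max_left _ _).trans hMℓ
  have hℓ0 : 0 < ell D := by linarith
  have hCε : (4 * |C| / ε) ^ 2 ≤ ell D := (le_max_right _ _).trans hMℓ
  have hη : ‖S D χ j - frake j * (frakA χ : ℂ) * (Nat.totient D : ℂ) / (D : ℂ)‖ ≤ |C| / ell D :=
    (h1 hA j hj).trans (by gcongr; exact le_abs_self C)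
  have ht0 : 0 ≤ (D : ℝ) / Nat.totient D := by positivity
  -- `log 𝓛 ≤ 2√𝓛` and `√𝓛 ≥ 4|C|/ε`
  have hs0 : 0 < Real.sqrt (ell D) := Real.sqrt_pos.mpr hℓ0
  have hlog : Real.log (ell D) ≤ 2 * Real.sqrt (ell D) := by
    have h := Real.log_le_rpow_div hℓ0.le (by norm_num : (0:ℝ) < 1 / 2)
    rw [Real.sqrt_eq_rpow]
    linarith
  have hsq : 4 * |C| / ε ≤ Real.sqrt (ell D) := by
    have h0 : 0 ≤ 4 * |C| / ε := by positivity
    calc 4 * |C| / ε = Real.sqrt ((4 * |C| / ε) ^ 2) := (Real.sqrt_sq h0).symm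
      _ ≤ Real.sqrt (ell D) := Real.sqrt_le_sqrt hCε
  have hss : Real.sqrt (ell D) * Real.sqrt (ell D) = ell D := Real.mul_self_sqrt hℓ0.le
  have h4 : 4 * |C| ≤ ε * Real.sqrt (ell D) := by
    rw [div_le_iff₀ hε] at hsq; linarith
  calc (D : ℝ) / Nat.totient D * ‖S D χ j - frake j * (frakA χ : ℂ) * (Nat.totient D : ℂ) / (D : ℂ)‖
      ≤ (2 * Real.log (ell D)) * (|C| / ell D) :=
        mul_le_mul ht hη (norm_nonneg _) (by linarith [Real.log_nonneg hℓ1])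
    _ ≤ (2 * (2 * Real.sqrt (ell D))) * (|C| / ell D) := by gcongr
    _ = 4 * |C| * Real.sqrt (ell D) / ell D := by ring
    _ ≤ ε * Real.sqrt (ell D) * Real.sqrt (ell D) / ell D := by gcongr
    _ = ε := by rw [mul_assoc, hss]; field_simp

/-- **(15.24) from (15.6), (15.17), the REPAIRED (15.23) (rate `O(1/𝓛)`) and `ℛ₁*ℛ₁ⱼ = (1,2,1) +
O(𝓛⁻⁵)`**, abstract in the §15A/B objects. [cite: Zhang2022LandauSiegel, §15 (15.24) p.88] -/
theorem eval1524_of_rates_R {c' : ℝ}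
    {Φp S R : ∀ (D : ℕ) [NeZero D], DirichletCharacter ℂ D → ℕ → ℂ}
    {Rs : ∀ (D : ℕ) [NeZero D], DirichletCharacter ℂ D → ℂ}
    (h6 : ∀ ε : ℝ, 0 < ε → ForAllLarge fun D _ χ => AssumptionA D χ →
      ‖Phi1 c' χ - ∑ p ∈ primeWindow D, Φp D χ p‖ ≤ ε * frakP D)
    (h17 : ∀ ε : ℝ, 0 < ε → ForAllLarge fun D _ χ => AssumptionA D χ → ∀ p ∈ primeWindow D,
      ‖Φp D χ p - Rs D χ * (D : ℂ) * (p : ℂ) / (Nat.totient D : ℂ) *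
          ∑ j ∈ ({1, 2, 3} : Finset ℕ), R D χ j * S D χ j‖ ≤ ε * p)
    (h23R : ∃ C : ℝ, ForAllLarge fun D _ χ => AssumptionA D χ → ∀ j ∈ ({1, 2, 3} : Finset ℕ),
      ‖S D χ j - frake j * (frakA χ : ℂ) * (Nat.totient D : ℂ) / (D : ℂ)‖ ≤ C / ell D)
    (hprod : ∃ C : ℝ, ForAllLarge fun D _ χ => AssumptionA D χ →
      ‖Rs D χ * R D χ 1 - 1‖ ≤ C / ell D ^ 5 ∧ ‖Rs D χ * R D χ 2 - 2‖ ≤ C / ell D ^ 5 ∧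
        ‖Rs D χ * R D χ 3 - 1‖ ≤ C / ell D ^ 5) :
    Eval1524 c' :=
  eval1524_of_coeff h6 h17 (coeff_eventually (eta_small_of_rate1 h23R) (delta_small_of_rate5 hprod))

/-- **(15.24) from the typed displays (15.6), (15.17), (15.22), u056, u058, u059** — bypassing
(15.23): (15.22) + u056 give (15.23) with `O(1/𝓛)` (`eq15_23R_of_eq15_22`), which still suffices
(`eval1524_of_rates_R`). Printed coefficient reading `bLit`, instance `inputs15AB`.
[cite: Zhang2022LandauSiegel, §15 (15.24) p.88] -/
theorem eval1524_of_displays_R (c' : ℝ) (h6 : Section15A.Eq15_6 c' Section15A.bLit)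
    (h17 : Section15B.Eq15_17 c' Section15A.bLit)
    (h22 : Section15C.Eq15_22 c' Section15C.inputs15AB)
    (h56 : Section15C.Step15_u056 c' Section15C.inputs15AB)
    (h58 : Section15C.Step15_u058 c' Section15C.inputs15AB)
    (h59 : Section15C.Step15_u059 c' Section15C.inputs15AB) : Eval1524 c' :=
  eval1524_of_rates_R
    (Φp := fun D _ χ p => Section15A.Phi1pOf c' χ (Section15A.bLit D χ) p)
    (S := fun D _ χ j => Section15B.calS1 c' χ (Section15A.bLit D χ) j)
    (R := fun _ _ χ j => Section15B.calR1 c' χ j)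
    (Rs := fun _ _ χ => Section15A.calR1star c' χ)
    h6 h17 (eq15_23R_of_eq15_22 c' _ h22 h56) (prod_rate5_of_values c' h58 h59)

/-- The banked coarse node `Skeleton.Ded1524 c′` from the displays (15.6), (15.17), (15.22), u056,
u058, u059. [cite: Zhang2022LandauSiegel, §15 (15.1)–(15.24)] -/
theorem ded1524_of_displays_R (c' : ℝ) (h6 : Section15A.Eq15_6 c' Section15A.bLit)
    (h17 : Section15B.Eq15_17 c' Section15A.bLit)
    (h22 : Section15C.Eq15_22 c' Section15C.inputs15AB)
    (h56 : Section15C.Step15_u056 c' Section15C.inputs15AB)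
    (h58 : Section15C.Step15_u058 c' Section15C.inputs15AB)
    (h59 : Section15C.Step15_u059 c' Section15C.inputs15AB) : Ded1524 c' :=
  fun _ _ _ _ => eval1524_of_displays_R c' h6 h17 h22 h56 h58 h59

end Literature.NumberTheory.LFunctions.Zhang2022.Ded1524
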